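import Summits.QuantumFields.YangMills.Theorems.BalabanUVNodesN22AtW1Reading12
import Summits.QuantumFields.YangMills.Theorems.BalabanUVNodesN16AtRRec12ConstLayer
import Literature.MathematicalPhysics.QuantumFieldTheory.Balaban1983to89.Node00.RateRecord11NE3Data

/-!
# THE RATE READING OF RECORD AT STAGE 12, EDITION 1 — `YMDAG.UVSplit.readingOfRecord₁₂ w1 ℓ₃ ne2 ne1 : RateReading₁₂ N`: the (T-RATE) home's reading with the TWO
# components the definers have PINNED BY NAME plugged in — node U3's objects := node00-def-W1's W1 reading `(w1 F θ).u3Objects θ.γ` (`Node00/RateRecordW1Reading`,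
# p465810) and N16's NE3 layer := node00-def-RR-1's CONSTANT LAYER OF RECORD `ne3ConstLayerOfRecord₁₁ F N (ℓ₃ F)` (`Node00/RateRecord11NE3Data`, p467746) — the other two
# (N15's `ne2`, NODE O's dressed tower `ne1`) still RESIDUAL parameters; and what the K4 stubs at `RRec₁₂ (readingOfRecord₁₂ …)` SAY, by name

Track A of `YM-PLAN.md` (cell `pub-ymgap`, HUMAN RULING D-0062), R134 seat `pub-ymgap-dag-n22-e` ((T-RATE) pen), gen 2, module 6.  WHY.  «A skeleton quoting `S_N1x (RRec₁₂ 𝔯)`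
NAMES its `𝔯`» (layer B's binding framing): this module NAMES the reading of record as far as the tree's definers have pinned it tonight, so that N16's and N22's stubs at
the Stage-12 home become sentences about NAMED objects — RR-1's unit-lattice data of the record (`ne3DomOfRecord₁₁`, all `2·L^m`-periodic `SU(N)`-valued configurations,
letters `ℓ₃ F` parametric = THE END's thresholds) and W1's towers of (2.14) terms `(w1 F θ).S k` (residual DATA inside the named container) — while `ne2` and `ne1` stay
explicit parameters (N15's paired instances and NODE O's dressed tower have no Literature pin yet).  node00-def-RR-1 g4 LANDED-3 (pub-ymgap INBOX l.13869): «★ dag-n22-e: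
the layer-B ₁₂ pin of `RateObjects.ne3` — this leaf is the import»; dag-n16-e g2 `…N16AtRRec12ConstLayer` (p46xxxx): «`hconst` is `rfl` for a reading defined as
`fun _ ↦ o F`» — here it is.  Definition lane (two `def`s); every theorem is kernel bookkeeping; 0 `sorry`; COUNT-NEUTRAL; `--supports` K3″ `SpineGivenEndpointR12`
(stmt-QuantumFields-19908) as a helper.  Restate-immune (no Theses import); nothing landed is re-keyed (the reading is an INSTANCE of layer B's `RateReading₁₂`).

WHAT THIS MODULE PROVES ([bookkeeping]).
* §1 `pinnedInputs₁₂ w1 ℓ₃ ne2 : W1.AssignmentInputs₁₂ N` (W1's input container with `ne3 := fun F _ _ _ => ne3ConstReadingOfRecord₁₁ F N (ℓ₃ F)`) ·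
  `readingOfRecord₁₂ w1 ℓ₃ ne2 ne1 := RateReading₁₂.ofAssignment (W1.assignment₁₂ (pinnedInputs₁₂ w1 ℓ₃ ne2)) ne1` · component faces `readingOfRecord₁₂_u3 ∕ _ne3 ∕ _ne2 ∕ _ne1`
  (`rfl`) · `readingOfRecord₁₂_populated_iff` (the reading's objects are POPULATED iff N15's residual layer is — W1's U3 layer and RR-1's constant layer are populated
  unconditionally).
* §2 WHAT THE STUBS SAY AT `RRec₁₂ (readingOfRecord₁₂ …)`: `s_N16_readingOfRecord₁₂_iff` (N16 = `N16At (ne3OfRecord₁₁ F (ne3ConstLayerOfRecord₁₁ F N (ℓ₃ F)))` at every family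
  carrying a Stage-12 datum of record — ONE sentence per family; n16-e's `s_N16_rRec₁₂_iff_of_constLayer` with `hconst := rfl`) · `s_N22_readingOfRecord₁₂_iff` ∕ `_iff_ne9`
  (N22 = the history-Lipschitz inequality for W1's `Re E(S k)(X; ·; embA U)` per key and run length — module 4) · `s_N22_readingOfRecord₁₂_of_oscAnalytic` (ROAD 3) ·
  `s_N18_readingOfRecord₁₂_iff` (N18 = NE5 of W1's level pairings at every key, run length and member `b`) · `s_N15 ∕ s_N14_readingOfRecord₁₂_iff` (the residual components,
  read at the canonical parameter) · `s_N17 ∕ s_D4_readingOfRecord₁₂_iff` (on the datum, W1's bundle).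
* §3 HONESTY: `s_N22_readingOfRecord₁₂_of_EA_zero` (vanishing W1 towers close N22's stub — module 4's rider at the reading of record: the towers are DATA, not yet the
  construction's (2.14) terms).

HONEST FRAMING.  Two pins CONSUMED BY NAME (W1's container — whose towers are residual data —, RR-1's constant NE3 layer — a pin CONVENTION with parametric letters); two
components residual; every node estimate (NE1′, NE2, NE3 — `InEndRegime`∕`PrintSlot` —, NE4, NE5, NE9) is a DISPLAYED hypothesis with no producer at this reading today; nothing
of Bałaban's is asserted or instantiated; NE1′–NE9 are NOT PRINTED for d = 4 and NOT PROVED; no inhabitant of `IsDatumOfRecord₁₂C` claimed (K0″ `Record12Inhabited`,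
stmt-QuantumFields-19902, open); no node discharged; counts UNMOVED (typed 28∕28 · discharged 5∕27, A 5∕28); one finite four-torus programme at fixed `ε` — NOT ℝ⁴, NOT infinite
volume, NOT OS, NOT a mass gap, NOT Clay.  No decl below carries a cite tag.
-/

noncomputable section

namespace YMDAG.UVSplit

open Literature.MathematicalPhysics.QuantumFieldTheory.Balaban1983to89
open Literature.MathematicalPhysics.QuantumFieldTheory.Balaban1983to89.T4Continuum
open Literature.MathematicalPhysics.QuantumFieldTheory.Balaban1983to89.T4OutputRate (Window NE9)
open Node00 (Stage12Params datumOfRecord₁₂ IsDatumOfRecord₁₂C NE2Objects₁₁ NE3Letters₁₁ ne3ConstLayerOfRecord₁₁ ne3ConstReadingOfRecord₁₁)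
open Node00.Sect2 (domSys)
open Node00.W1 (ReadingData AssignmentInputs₁₂ assignment₁₂ functionalC)
open Summit.QuantumFields.YangMills.BalabanUVNodes.N16AtRRec12ConstLayer (s_N16_rRec₁₂_iff_of_constLayer n16At_of_s_N16_rRec₁₂_constLayer)

variable {N : ℕ} [NeZero N]

/-! ## §1 The pinned inputs and the reading of record, edition 1 -/

/-- **THE PINNED INPUTS, EDITION 1**: W1's input container (`W1.AssignmentInputs₁₂ N`) with the NE3 slot FILLED by RR-1's constant reading of record
`ne3ConstReadingOfRecord₁₁ F N (ℓ₃ F)` (one `2·L^m`-periodic unit-lattice layer per family, letters `ℓ₃ F`), W1's reading data `w1` and N15's residual layer `ne2` passed through. -/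
def pinnedInputs₁₂ (w1 : (F : T4Family) → (θ : Stage12Params F N) → ReadingData F (Node00.MatA N) θ.τ9.M) (ℓ₃ : T4Family → NE3Letters₁₁)
    (ne2 : (F : T4Family) → Stage12Params F N → (ℕ → ℝ) → List (ULoop F) → ℕ → NE2Objects₁₁) : AssignmentInputs₁₂ N :=
  ⟨w1, fun F _ _ _ => ne3ConstReadingOfRecord₁₁ F N (ℓ₃ F), ne2⟩

/-- **THE RATE READING OF RECORD AT STAGE 12, EDITION 1** — layer B's `RateReading₁₂.ofAssignment` of W1's assignment at the pinned inputs, with NODE O's dressed-tower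
assignment `ne1` (residual) in the N14 slot. -/
def readingOfRecord₁₂ (w1 : (F : T4Family) → (θ : Stage12Params F N) → ReadingData F (Node00.MatA N) θ.τ9.M) (ℓ₃ : T4Family → NE3Letters₁₁)
    (ne2 : (F : T4Family) → Stage12Params F N → (ℕ → ℝ) → List (ULoop F) → ℕ → NE2Objects₁₁)
    (ne1 : (F : T4Family) → Stage12Params F N → (ℕ → ℝ) → List (ULoop F) → NE1pCarriers) : RateReading₁₂ N :=
  RateReading₁₂.ofAssignment (assignment₁₂ (pinnedInputs₁₂ w1 ℓ₃ ne2)) ne1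

section Faces

variable (w1 : (F : T4Family) → (θ : Stage12Params F N) → ReadingData F (Node00.MatA N) θ.τ9.M) (ℓ₃ : T4Family → NE3Letters₁₁)
  (ne2 : (F : T4Family) → Stage12Params F N → (ℕ → ℝ) → List (ULoop F) → ℕ → NE2Objects₁₁)
  (ne1 : (F : T4Family) → Stage12Params F N → (ℕ → ℝ) → List (ULoop F) → NE1pCarriers)

/-- Face: node U3's objects of the reading of record ARE W1's at window radius `θ.γ` (`rfl`). -/
theorem readingOfRecord₁₂_u3 (F : T4Family) (θ : Stage12Params F N) (hP : θ.Provisos₁₂ F N) (g₀ : ℕ → ℝ) (os : List (ULoop F)) :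
    ((readingOfRecord₁₂ w1 ℓ₃ ne2 ne1).lit F θ hP g₀ os).u3 = (w1 F θ).u3Objects θ.γ := rfl

/-- Face: N16's layer of the reading of record IS RR-1's constant layer of record at EVERY run length (`rfl`) — n16-e's `hconst`. -/
theorem readingOfRecord₁₂_ne3 (F : T4Family) (θ : Stage12Params F N) (hP : θ.Provisos₁₂ F N) (g₀ : ℕ → ℝ) (os : List (ULoop F)) (k : ℕ) :
    ((readingOfRecord₁₂ w1 ℓ₃ ne2 ne1).lit F θ hP g₀ os).ne3 k = ne3ConstLayerOfRecord₁₁ F N (ℓ₃ F) := rfl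

/-- Face: N15's layer is the residual one (`rfl`). -/
theorem readingOfRecord₁₂_ne2 (F : T4Family) (θ : Stage12Params F N) (hP : θ.Provisos₁₂ F N) (g₀ : ℕ → ℝ) (os : List (ULoop F)) (k : ℕ) :
    ((readingOfRecord₁₂ w1 ℓ₃ ne2 ne1).lit F θ hP g₀ os).ne2 k = ne2 F θ g₀ os k := rfl

/-- Face: N14's dressed tower is the residual one (`rfl`). -/
theorem readingOfRecord₁₂_ne1 (F : T4Family) (θ : Stage12Params F N) (hP : θ.Provisos₁₂ F N) (g₀ : ℕ → ℝ) (os : List (ULoop F)) :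
    (readingOfRecord₁₂ w1 ℓ₃ ne2 ne1).ne1 F θ hP g₀ os = ne1 F θ g₀ os := rfl

/-- **THE READING OF RECORD IS POPULATED IFF N15's RESIDUAL LAYER IS** — W1's U3 layer (`assignment₁₂_u3_populated`) and RR-1's constant NE3 layer
(`populated_ne3ConstLayerOfRecord₁₁`) are populated UNCONDITIONALLY (RR-1 §8's displayed non-degeneracy, two thirds met by name). -/
theorem readingOfRecord₁₂_populated_iff (F : T4Family) (θ : Stage12Params F N) (hP : θ.Provisos₁₂ F N) (g₀ : ℕ → ℝ) (os : List (ULoop F)) :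
    ((readingOfRecord₁₂ w1 ℓ₃ ne2 ne1).lit F θ hP g₀ os).Populated ↔ ∀ k, (ne2 F θ g₀ os k).Populated :=
  (Node00.W1.assignment₁₂_populated_iff (pinnedInputs₁₂ w1 ℓ₃ ne2) F θ g₀ os).trans
    ⟨fun h => h.2, fun h => ⟨fun _ => Node00.populated_ne3ConstLayerOfRecord₁₁ F N (ℓ₃ F), h⟩⟩

/-! ## §2 What the K4 stubs say at `RRec₁₂ (readingOfRecord₁₂ w1 ℓ₃ ne2 ne1)` -/

/-- **N16 AT THE READING OF RECORD**: `S_N16` IS «`N16At (ne3OfRecord₁₁ F (ne3ConstLayerOfRecord₁₁ F N (ℓ₃ F)))` for every family carrying a Stage-12 datum of record» — ONE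
sentence per family about RR-1's NAMED unit-lattice data (n16-e's `s_N16_rRec₁₂_iff_of_constLayer`, `hconst := rfl`). -/
theorem s_N16_readingOfRecord₁₂_iff :
    S_N16 (RRec₁₂ (readingOfRecord₁₂ w1 ℓ₃ ne2 ne1)) ↔
      ∀ (F : T4Family), (∃ D : Datum F N, IsDatumOfRecord₁₂C F N D) → N16At (ne3OfRecord₁₁ F (ne3ConstLayerOfRecord₁₁ F N (ℓ₃ F))) :=
  s_N16_rRec₁₂_iff_of_constLayer (readingOfRecord₁₂ w1 ℓ₃ ne2 ne1) (fun F => ne3ConstLayerOfRecord₁₁ F N (ℓ₃ F)) fun _ _ _ _ _ _ => rfl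

/-- … so under `S_N16` at the reading of record, `N16At` holds at RR-1's layer of every family with a datum of record (n21-d's `h16` binder, named). -/
theorem n16At_of_s_N16_readingOfRecord₁₂ (hS : S_N16 (RRec₁₂ (readingOfRecord₁₂ w1 ℓ₃ ne2 ne1))) (F : T4Family) {D : Datum F N}
    (hD : IsDatumOfRecord₁₂C F N D) : N16At (ne3OfRecord₁₁ F (ne3ConstLayerOfRecord₁₁ F N (ℓ₃ F))) :=
  n16At_of_s_N16_rRec₁₂_constLayer (readingOfRecord₁₂ w1 ℓ₃ ne2 ne1) (fun F => ne3ConstLayerOfRecord₁₁ F N (ℓ₃ F)) (fun _ _ _ _ _ _ => rfl) hS F hD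

/-- **N22 AT THE READING OF RECORD**: `S_N22` IS «`N22At` at every Stage-12 datum key and run length of W1's objects at the canonical parameter» (module 4; `ne1 ∕ ne2 ∕ ne3`,
`g₀`, `os` idle). -/
theorem s_N22_readingOfRecord₁₂_iff :
    S_N22 (RRec₁₂ (readingOfRecord₁₂ w1 ℓ₃ ne2 ne1)) ↔
      ∀ (F : T4Family) (D : Datum F N) (h : IsDatumOfRecord₁₂C F N D) (k : ℕ), N22At (u3OfRecord₁₂ h.params ((w1 F h.params).u3Objects h.params.γ) k) :=
  YMDAG.N22.s_N22_rRec₁₂_w1_iff (pinnedInputs₁₂ w1 ℓ₃ ne2) ne1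

/-- **… IN PRINT-LIKE FORM** (under the analytic blocks' signs at the canonical parameters): the history-Lipschitz inequality for `Re E((w1 F θ).S k)(X; ·; embA U)` on
`]0, θ.γ]` per key and run length (module 4's `s_N22_rRec₁₂_w1_iff_ne9`). -/
theorem s_N22_readingOfRecord₁₂_iff_ne9
    (hs : ∀ (F : T4Family) (D : Datum F N) (h : IsDatumOfRecord₁₂C F N D), ((w1 F h.params).li.analytic h.params.γ).Signs) :
    S_N22 (RRec₁₂ (readingOfRecord₁₂ w1 ℓ₃ ne2 ne1)) ↔
      ∀ (F : T4Family) (D : Datum F N) (h : IsDatumOfRecord₁₂C F N D) (k : ℕ),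
        ∀ g ∈ Window h.params.γ, ∀ g' ∈ Window h.params.γ,
          ∀ (U : ((w1 F h.params).pairing k).BgA) (X : Node00.W1.Dom (F.P k) h.params.τ9.M),
            |(functionalC ((w1 F h.params).S k) g (((w1 F h.params).pairing k).embA U) X).re -
                (functionalC ((w1 F h.params).S k) g' (((w1 F h.params).pairing k).embA U) X).re| ≤
              Real.exp (-(((w1 F h.params).li.analytic h.params.γ).κ * (domSys (F.P k) h.params.τ9.M X.1).dj X.2)) *
                ∑ i ∈ Finset.range X.1, ((w1 F h.params).li.analytic h.params.γ).moduli X.1 i * |g i - g' i| :=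
  YMDAG.N22.s_N22_rRec₁₂_w1_iff_ne9 (pinnedInputs₁₂ w1 ℓ₃ ne2) ne1 hs

/-- **ROAD 3 AT THE READING OF RECORD** (module 4's `s_N22_rRec₁₂_w1_of_oscAnalytic` at the pinned inputs). -/
theorem s_N22_readingOfRecord₁₂_of_oscAnalytic
    (hnum : ∀ (F : T4Family) (θ : Stage12Params F N), θ.Provisos₁₂ F N → θ.Admissible F N →
      0 < (w1 F θ).li.C₀ ∧ 0 < (w1 F θ).li.θ₅ ∧ 0 < (w1 F θ).li.A ∧ (w1 F θ).li.θ₅ ≤ (w1 F θ).li.μ ∧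
        (w1 F θ).li.C₀ ≤ 2 * (w1 F θ).li.A ∧ 0 < (w1 F θ).li.r ∧ 0 < (w1 F θ).li.s ∧ (w1 F θ).li.s < 1)
    (hO : ∀ (F : T4Family) (θ : Stage12Params F N), θ.Provisos₁₂ F N → θ.Admissible F N → ∀ (k : ℕ),
      ∀ g ∈ Window θ.γ, ∀ g' ∈ Window θ.γ, ∀ (U : (((w1 F θ).u3Objects θ.γ).levelCarriers k).BgA)
        (X : (((w1 F θ).u3Objects θ.γ).levelCarriers k).Dom) (a : ℕ), a ≤ (((w1 F θ).u3Objects θ.γ).levelCarriers k).scale X →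
        (∀ n, a ≤ n → g n = g' n) →
          |((w1 F θ).u3Objects θ.γ).EA k g U X - ((w1 F θ).u3Objects θ.γ).EA k g' U X| ≤
            (w1 F θ).li.C₀ * ((w1 F θ).u3Objects θ.γ).θ₅ ^ ((((w1 F θ).u3Objects θ.γ).levelCarriers k).scale X - a) *
              Real.exp (-(((w1 F θ).u3Objects θ.γ).κ * (((w1 F θ).u3Objects θ.γ).levelCarriers k).d X)))
    (hA : ∀ (F : T4Family) (θ : Stage12Params F N), θ.Provisos₁₂ F N → θ.Admissible F N → ∀ (k : ℕ),
      ∀ g ∈ Window θ.γ, ∀ (U : (((w1 F θ).u3Objects θ.γ).levelCarriers k).BgA) (X : (((w1 F θ).u3Objects θ.γ).levelCarriers k).Dom) (i : ℕ),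
        i < (((w1 F θ).u3Objects θ.γ).levelCarriers k).scale X → ∃ (Fz : ℂ → ℂ) (Dset : Set ℂ), DifferentiableOn ℂ Fz Dset ∧
          (∀ z ∈ Dset, ‖Fz z‖ ≤ (w1 F θ).li.A * (w1 F θ).li.μ ^ ((((w1 F θ).u3Objects θ.γ).levelCarriers k).scale X - 1 - i) *
            Real.exp (-(((w1 F θ).u3Objects θ.γ).κ * (((w1 F θ).u3Objects θ.γ).levelCarriers k).d X))) ∧
          (∀ t ∈ Set.Ioc (0 : ℝ) θ.γ, Metric.closedBall (t : ℂ) (w1 F θ).li.r ⊆ Dset) ∧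
          (∀ t ∈ Set.Ioc (0 : ℝ) θ.γ, Fz t = (((w1 F θ).u3Objects θ.γ).EA k (Function.update g i t) U X : ℂ))) :
    S_N22 (RRec₁₂ (readingOfRecord₁₂ w1 ℓ₃ ne2 ne1)) :=
  YMDAG.N22.s_N22_rRec₁₂_w1_of_oscAnalytic (pinnedInputs₁₂ w1 ℓ₃ ne2) ne1 hnum hO hA

/-- **N18 AT THE READING OF RECORD**: `S_N18` IS «NE5 at every Stage-12 datum key, run length `k` and member `b ∈ ]0, θ.γ]` of W1's level-`k` pairing» (`g₀`, `os` idle;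
layer B's `s_N18_rRec₁₂_iff`; W1's `ne5_u3Objects_iff` unfolds it to the printed-shape inequality). -/
theorem s_N18_readingOfRecord₁₂_iff :
    S_N18 (RRec₁₂ (readingOfRecord₁₂ w1 ℓ₃ ne2 ne1)) ↔
      ∀ (F : T4Family) (D : Datum F N) (h : IsDatumOfRecord₁₂C F N D) (k : ℕ), N18At (u3OfRecord₁₂ h.params ((w1 F h.params).u3Objects h.params.γ) k) := by
  rw [s_N18_rRec₁₂_iff]
  exact ⟨fun H F D h k => H F D h (fun _ => 0) [] k, fun H F D h _ _ k => H F D h k⟩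

/-- **N15 AT THE READING OF RECORD** — the residual component, read at the canonical parameter (layer B's face, component `rfl`). -/
theorem s_N15_readingOfRecord₁₂_iff :
    S_N15 (RRec₁₂ (readingOfRecord₁₂ w1 ℓ₃ ne2 ne1)) ↔
      ∀ (F : T4Family) (D : Datum F N) (h : IsDatumOfRecord₁₂C F N D) (g₀ : ℕ → ℝ) (os : List (ULoop F)) (k : ℕ),
        N15At (ne2OfRecord₁₁ (ne2 F h.params g₀ os k)) :=
  s_N15_rRec₁₂_iff _

/-- **N14 AT THE READING OF RECORD** — the residual dressed tower, read at the canonical parameter. -/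
theorem s_N14_readingOfRecord₁₂_iff :
    S_N14 (RRec₁₂ (readingOfRecord₁₂ w1 ℓ₃ ne2 ne1)) ↔
      ∀ (F : T4Family) (D : Datum F N) (h : IsDatumOfRecord₁₂C F N D) (g₀ : ℕ → ℝ) (os : List (ULoop F)), N14At (ne1 F h.params g₀ os) :=
  s_N14_rRec₁₂_iff _

/-- **N17 AT THE READING OF RECORD** — NE4 on the datum at the dependent letters of W1's analytic block (`g₀`, `os` idle). -/
theorem s_N17_readingOfRecord₁₂_iff :
    S_N17 (RRec₁₂ (readingOfRecord₁₂ w1 ℓ₃ ne2 ne1)) ↔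
      ∀ (F : T4Family) (D : Datum F N) (h : IsDatumOfRecord₁₂C F N D) (k : ℕ), N17At D (u3OfRecord₁₂ h.params ((w1 F h.params).u3Objects h.params.γ) k) := by
  rw [s_N17_rRec₁₂_iff]
  exact ⟨fun H F D h k => H F D h (fun _ => 0) [] k, fun H F D h _ _ k => H F D h k⟩

/-- **(D4) AT THE READING OF RECORD** — the β-read-out binders on the datum at W1's bundles (`g₀`, `os` idle). -/
theorem s_D4_readingOfRecord₁₂_iff :
    S_D4 (RRec₁₂ (readingOfRecord₁₂ w1 ℓ₃ ne2 ne1)) ↔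
      ∀ (F : T4Family) (D : Datum F N) (h : IsDatumOfRecord₁₂C F N D) (k : ℕ), ReadOutAt D (u3OfRecord₁₂ h.params ((w1 F h.params).u3Objects h.params.γ) k) := by
  rw [s_D4_rRec₁₂_iff]
  exact ⟨fun H F D h k => H F D h (fun _ => 0) [] k, fun H F D h _ _ k => H F D h k⟩

/-! ## §3 Honesty at the reading of record -/

/-- **VANISHING W1 TOWERS CLOSE N22's STUB AT THE READING OF RECORD** (module 4's rider here): the towers inside `w1` are residual DATA; a discharge of
`S_N22 (RRec₁₂ (readingOfRecord₁₂ w1 …))` owes the identification of `(w1 F θ).S k` with the construction's (2.14) terms. -/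
theorem s_N22_readingOfRecord₁₂_of_EA_zero
    (hs : ∀ (F : T4Family) (θ : Stage12Params F N), θ.Provisos₁₂ F N → θ.Admissible F N → ((w1 F θ).li.analytic θ.γ).Signs)
    (h0 : ∀ (F : T4Family) (θ : Stage12Params F N), θ.Provisos₁₂ F N → θ.Admissible F N → ∀ (k : ℕ) (g : ℕ → ℝ)
      (U : (((w1 F θ).u3Objects θ.γ).levelCarriers k).BgA) (X : (((w1 F θ).u3Objects θ.γ).levelCarriers k).Dom), ((w1 F θ).u3Objects θ.γ).EA k g U X = 0) :
    S_N22 (RRec₁₂ (readingOfRecord₁₂ w1 ℓ₃ ne2 ne1)) :=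
  YMDAG.N22.s_N22_rRec₁₂_w1_of_EA_zero (pinnedInputs₁₂ w1 ℓ₃ ne2) ne1 hs h0

end Faces

end YMDAG.UVSplit

end
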